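import Literature.Barriers.AtomisticToContinuum.WildSolutionsProofs
import Literature.Analysis.FluidPDE.ConvexIntegration2DBallProofs

/-!
# Discharge of named literature fact(s) by composition

This file only composes reductions and discharges that are already in the tree
(no new definitions, no new named facts): each `theorem X_holds : X` below feeds the
proved hypotheses into an existing reduction theorem.  Net effect: the listed facts
stop being literature debt.
-/

namespace Literature.Barriers.AtomisticToContinuum

/-- **Markfelder 2021, Thm 8.3.1 for the symmetric two-shock data, proved.** Discharge of
`WildSolutionsBarrier` (for every `1 < γ < 3`, `a > 0`, the Riemann data `ρ± = p± = 1`,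
`u± = (0, ±a)` of the two-dimensional full compressible Euler system admit infinitely many
pairwise essentially different admissible weak solutions with density and pressure bounded
below) from the proved two-dimensional convex-integration lemma of Chiodaroli–De Lellis–Kreml on
the ball (`ConvexIntegrationLemma2DBall_holds`,
`Literature/Analysis/FluidPDE/ConvexIntegration2DBallProofs.lean`) via
`WildSolutionsBarrier_of_convexIntegrationLemma2DBall`
(`Literature/Barriers/AtomisticToContinuum/WildSolutionsProofs.lean`: the admissible fan
subsolution `exists_fan_parameters`, the gluing `isAdmissibleWeakSolution_glued`, and the
Besicovitch reduction `convexIntegrationLemma2D_of_ball`).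
[cite: Markfelder2021, Thm 8.3.1, Thm 8.3.4, Prop. 8.3.5, §8.3.3] [cite: ChiodaroliDeLellisKreml2015, Lemma 3.7, Prop. 3.6] -/
theorem WildSolutionsBarrier_holds : WildSolutionsBarrier :=
  WildSolutionsBarrier_of_convexIntegrationLemma2DBall
    Literature.Analysis.FluidPDE.ConvexIntegration.ConvexIntegrationLemma2DBall_holds

end Literature.Barriers.AtomisticToContinuum
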